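import Literature.MathematicalPhysics.QuantumFieldTheory.Balaban1983to89.B7Prop4LinCovIterLinearBound
import Literature.MathematicalPhysics.QuantumFieldTheory.Balaban1983to89.B7Prop4LinCovIterClosedLaws
import Literature.MathematicalPhysics.QuantumFieldTheory.Balaban1983to89.B7Eq52RetractionExtension
import Literature.MathematicalPhysics.QuantumFieldTheory.Balaban1983to89.B9Eq3124HZKnitPairReg335Y

/-!
# `Balaban1983to89.B9Eq315QknitSizesY` — T. Bałaban, *Propagators for lattice gauge theories in a background field*, Commun. Math. Phys. **99** (1985) 389–434
# [Balaban1985BackgroundPropagators], (3.12)–(3.15) p. 393 with *Averaging operations for lattice gauge theories*, CMP **98** (1985) [Balaban1985Averaging], p. 24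
# (locality) + Prop. 2 p. 26 (the retraction) + Prop. 4 (130) p. 38: THE SIZE OF THE KNIT AVERAGING LETTER `Q_j(U)` AT AN INDEX BOND FROM THE (52) REGIME OF THE
# RETRACTED BACKGROUND `Û_ι` ONLY — the local (per-bond) form of the size law (L7) of the pub-ymgap N06 Q-letter law bundle, the shape dag-n06-l's (3.35)-keyed
# hypotheses feed (director-ym №375, obligation (5) «(L7) sizes := n06-c»)

statement-level skeleton of published theorems with citation tags; proofs where landed; nothing here is a claim about the Yang–Mills mass gap

THE PRINT.  [B9] (3.12)–(3.15) p. 393 (the averaging operators `Q_j(U)` and their sizes); [5] p. 24, verbatim: *«Let us notice that this definition is local in the sense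
that Ū^k_c, c ⊂ Ω^{(k)}, depends only on the bond variables U_b for b ⊂ B^k(c₋) ∪ B^k(c₊)»*; Prop. 2 p. 26 (the (52) class and its locality sentence); Prop. 4 (130) p. 38.

WHY THIS FILE (pub-ymgap node N06 [B9], O5 ∕ R2 re-pin; №375).  `B7Prop4LinCovIterLinearBound.norm_QknitY_apply_le` bounds `‖(Q(U)a)(ι)‖ ≤ 2‖a‖∞` when the WHOLE lift
`U♯` is in [5]'s (52) class at the member's top scale — a global hypothesis the member's LOCAL class (3.35) does not give (node00-def-Y's R2 design v3 §«REGIME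
CURRENCY»: regime laws are keyed to `Reg335 c₀ α₀ U` + x-free numerics, never to the global (52)).  By locality ([5] p. 24; dag-n06-l's `linCovIterC_congr`) the letter at
`ι` reads `U♯` only on the double block `B^j(ι₋) ∪ B^j(ι₊)`, so `U♯` may be replaced there by its RETRACTION `Û_ι` (`B7Eq52RetractionExtension.retrCfg`, flat off the
box) — and (52) is then needed for `Û_ι` at the bond's own scale `j(ι)` only, which is what (3.35) on the member supplies (dag-n06-l's `pdev_retract_bond_lt`, his
INTENT-5 `B9Eq3124HZKnitPairReg335Y`).  THIS FILE is that per-bond form: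
* ★★ `norm_QknitY_apply_le_of_retract` — `‖(QknitY i U a)(ι)‖ ≤ 2b` for `‖a‖ ≤ b`, `U` `G`-valued (`G` averaging-closed), under (52) FOR THE RETRACTION `Û_ι` at scale
  `j(ι)` (`pdev Û_ι < α₀′(L^{j(ι)})⁻²`) and the x-free numerics `C₀α₀′ ≤ 1∕3`, `4α₀′ ≤ c₂′`, `e^{4·800(d+2)²(d+5)α₀′} < 2`.
* ★★★ `norm_QknitY_apply_le_of_reg335P` — THE REGIME-OF-RECORD FORM (matrix algebra, `G ≤ U(N)` unit-bounded): hypothesis `(bg9KP … G i).Reg335 c₀ α₀ U` (the member's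
  LOCAL class (3.35), `c₀ ≤ 10`, `0 ≤ Mα₀`) + the x-free numerics `K_pl(Mα₀)L⁴ < α₀′`, `C₀α₀′ ≤ 1∕3`, `4α₀′ ≤ c₂′`, `e^{…α₀′} < 2` ⟹ `‖(QknitY i U a)(ι)‖ ≤ 2‖a‖` for the
  sup norm of `a` — EXACTLY node00-def-Y's law (L7) `IsBddOnQ (regQY G i c₀ α₀) (QknitY i) 2` unfolded (his `Node00/OpsYQLetter.IsBddOnQ 𝓡 𝔮 K := ∀ U, 𝓡 U → ∀ a ι,
  ‖𝔮 U a ι‖ ≤ K‖a‖`, `regQY G i c α₀ := (bg9KP 𝔸 G i).Reg335 c α₀`; his file cites this theorem by name for `qKnitOfRecord`), composed with dag-n06-l's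
  `B9Eq3124HZKnitPairReg335Y.pdev_retract_bond_lt` ((3.35) ⟹ (52) for `Û_ι` at scale `j(ι)`).

HONEST SCOPE ∕ NOT CLAIMED.  Locality bookkeeping + the landed linear bound; no new estimate; the (52) hypothesis on `Û_ι` is DISPLAYED here; count-neutral; (L7) NOT discharged
at the record; N06 NOT discharged; nothing continuum ∕ OS ∕ mass gap ∕ Clay.  NEW file; 0 `def`, no `sorry`, no `axiom`, no `instance`, no `notation`.  Cell `pub-ymgap`
(D-0062), seat `pub-ymgap-dag-n06-c` (gen 23), 2026-08-30; `--supports stmt-QuantumFields-27364`.  Net new unproved facts: 0.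

RELATED IN THE TREE, NOT DUPLICATED: `B7Prop4LinCovIterLinearBound` (the (52)-global form; USED), dag-n06-l `B7Prop4LinCovIterClosedLaws.linCovIterC_congr` (locality; USED),
`B7Eq52RetractionExtension` (`retrCfg`, `retrCfg_eq_of_bondIn`, `retrCfg_mem`; USED), dag-n06-l `B9Eq3124HZKnitPairReg335Y` (`pdev_retract_bond_lt` USED; his
`QknitY_gradY_apply_retract` is the same retraction pattern for the (3.115) face), node00-def-Y `Node00/OpsYQLetter` (the law (L7) `IsBddOnQ`; in flight).
-/

noncomputable section

open scoped BigOperators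
open NormedSpace Finset

namespace Literature.MathematicalPhysics.QuantumFieldTheory.Balaban1983to89.B9Eq315QknitSizesY

open B7Prop1Explicit B7Prop1Local B7Prop2Explicit B7Prop3Flat
open B7Prop5Flat (BondIn)
open B7Eq52RetractionExtension (retrCfg retrCfg_eq_of_bondIn retrCfg_mem)
open B7Prop4LinCovIterClosed (linCovIterC)
open B7Prop4LinCovIterClosedLaws (linCovIterC_congr)
open B7Prop4LinCovIterLinearBound (norm_linCovIterC_le_of_prop2 norm_liftBd_le_of_forall)
open B9Eq3124HZKnitPairReg335Y (pdev_retract_bond_lt)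
open B9C2FormBoxRegimeY (Kpl)
open B9BackgroundsKLevelV1P (bg9KP mem_of_reg335P)
open B6KLevelCensusIndexV1 (KIdx kGeo)
open B9B8CarrierDictionary (liftCfg liftCfg_mem)
open B9B8KnitBondTransfer (liftBd liftBd_apply)
open B9Eq3115KnitLetterY (QknitY QknitY_apply zSrc lvl_le')
open Node00 (FBondY IBondY CfgY)

-- `Site` alone would resolve to the torus sites of `Setup.lean`; re-export the `ℤ^d` sites of `B7Prop1Explicit`.
export B7Prop1Explicit (Site)

variable {d ℓ : ℕ} {hd : 1 ≤ d + 1} {hL : Odd (ℓ + 1) ∧ 1 < ℓ + 1} {b₀ b₁ : ℝ}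
variable {𝔸 : Type} [NormedRing 𝔸] [NormOneClass 𝔸] [NormedAlgebra ℂ 𝔸] [CompleteSpace 𝔸]
variable (i : KIdx d ℓ hd hL b₀ b₁)

/-- ★★ **THE SIZE OF `Q_j(U)` AT AN INDEX BOND FROM (52) FOR THE RETRACTED BACKGROUND `Û_ι` AT THE BOND's SCALE** ((3.15) p. 393; [5] p. 24 locality + Prop. 4 (130)): for
a `G`-valued member field `U` (`G` averaging-closed), an index bond `ι` of level `j = j(ι)`, and the retraction `Û_ι` of the lift `U♯` to the double block
`[Lʲz_ι, Lʲz_ι + (Lʲ − 1)𝟙 + Lʲe_κ]` with `pdev Û_ι < α₀′(Lʲ)⁻²`, `C₀α₀′ ≤ 1∕3`, `4α₀′ ≤ c₂′`, `e^{4·800((d+1)+1)²((d+1)+4)α₀′} < 2`: every bond function `a` with `‖a‖ ≤ b` has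
`‖(QknitY i U a)(ι)‖ ≤ 2b`.  (The letter at `ι` reads `U♯` only on that box — `linCovIterC_congr` — so it equals the letter at `Û_ι`, which is in the (52) class at scale `j`.)
[cite: Balaban1985BackgroundPropagators, (3.12)–(3.15) p.393; Balaban1985Averaging, p.24 (locality), Prop. 2 p.26, Proposition 4 (130) p.38] -/
theorem norm_QknitY_apply_le_of_retract {G : Subgroup 𝔸ˣ} (hG : AvgClosed (d + 1) (ℓ + 1) G) {U : CfgY 𝔸 i} (hU : ∀ μ x, U μ x ∈ G)
    {α₀' : ℝ} (hα' : 0 < α₀') (hα3 : C0 (d + 1) * α₀' ≤ 1 / 3) (hα4 : 4 * α₀' ≤ c2' (d + 1) (ℓ + 1))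
    (hexp : Real.exp (4 * (800 * (((d + 1 : ℕ) : ℝ) + 1) ^ 2 * (((d + 1 : ℕ) : ℝ) + 4)) * α₀') < 2) (ι : IBondY i)
    (h52 : pdev (retrCfg (loK (ℓ + 1) (ι.1.1 : ℕ) (zSrc i ι)) (bondHiK (ℓ + 1) (ι.1.1 : ℕ) (zSrc i ι) ι.1.2.dir) (liftCfg U))
      < α₀' * ((((ℓ + 1 : ℕ) : ℝ) ^ (ι.1.1 : ℕ))⁻¹) ^ 2)
    (a : FBondY i → 𝔸) {b : ℝ} (hb : 0 ≤ b) (ha : ∀ f, ‖a f‖ ≤ b) :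
    ‖QknitY i U a ι‖ ≤ 2 * b := by
  have hL1 : 1 ≤ ℓ + 1 := Nat.succ_pos ℓ
  have hLpos : (0 : ℝ) < ((ℓ + 1 : ℕ) : ℝ) := by exact_mod_cast Nat.succ_pos ℓ
  have hLj : (0 : ℝ) < ((ℓ + 1 : ℕ) : ℝ) ^ (ι.1.1 : ℕ) := pow_pos hLpos _
  set V : Site (d + 1) → Fin (d + 1) → 𝔸ˣ :=
    retrCfg (loK (ℓ + 1) (ι.1.1 : ℕ) (zSrc i ι)) (bondHiK (ℓ + 1) (ι.1.1 : ℕ) (zSrc i ι) ι.1.2.dir) (liftCfg U) with hV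
  -- the lift and its retraction agree on the bonds of the double block; the bond field agrees with itself
  have hagree : AgreeOn (loK (ℓ + 1) (ι.1.1 : ℕ) (zSrc i ι)) (bondHiK (ℓ + 1) (ι.1.1 : ℕ) (zSrc i ι) ι.1.2.dir) (liftCfg U) V :=
    fun x μ hx hxe => (retrCfg_eq_of_bondIn (liftCfg U) ⟨hx, hxe⟩).symm
  have hBB : AgreeOn (loK (ℓ + 1) (ι.1.1 : ℕ) (zSrc i ι)) (bondHiK (ℓ + 1) (ι.1.1 : ℕ) (zSrc i ι) ι.1.2.dir) (liftBd i a) (liftBd i a) :=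
    fun _ _ _ _ => rfl
  have hVG : ∀ x μ, V x μ ∈ G := fun x μ => retrCfg_mem (fun x μ => liftCfg_mem hU x μ) x μ
  -- the linear bound for the retraction at its own scale `j(ι)`
  have hlin := norm_linCovIterC_le_of_prop2 (ℓ + 1) hL.2 hG (ι.1.1 : ℕ) V hVG hα' hα3 hα4 (by exact_mod_cast h52) hexp (liftBd i a) hb
    (norm_liftBd_le_of_forall i a ha) (ι.1.1 : ℕ) le_rfl (zSrc i ι) ι.1.2.dir
  rw [QknitY_apply, linCovIterC_congr (ℓ + 1) hL1 (ι.1.1 : ℕ) (zSrc i ι) ι.1.2.dir hagree hBB, norm_smul, Complex.norm_real, Real.norm_eq_abs, abs_inv,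
    abs_of_pos hLj]
  have hcast : (((ℓ + 1 : ℕ) : ℕ) : ℝ) ^ (ι.1.1 : ℕ) = ((ℓ + 1 : ℕ) : ℝ) ^ (ι.1.1 : ℕ) := by norm_cast
  calc (((ℓ + 1 : ℕ) : ℝ) ^ (ι.1.1 : ℕ))⁻¹ * ‖linCovIterC (ℓ + 1) V (liftBd i a) (ι.1.1 : ℕ) (zSrc i ι) ι.1.2.dir‖
      ≤ (((ℓ + 1 : ℕ) : ℝ) ^ (ι.1.1 : ℕ))⁻¹ * (2 * ((((ℓ + 1 : ℕ) : ℕ) : ℝ) ^ (ι.1.1 : ℕ) * b)) :=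
        mul_le_mul_of_nonneg_left hlin (inv_nonneg.2 hLj.le)
    _ = 2 * b := by rw [hcast]; field_simp


/-! ## §2 The regime-of-record form: (L7) for the knit letter on the member's local class (3.35) -/

section Record

open scoped Matrix Matrix.Norms.L2Operator

variable {N : ℕ} [Nonempty (Fin N)] (i : KIdx d ℓ hd hL b₀ b₁) {G : Subgroup (Matrix (Fin N) (Fin N) ℂ)ˣ}

/-- ★★★ **(L7) «SIZES» FOR THE KNIT LETTER ON THE REGIME OF RECORD, `K = 2`**: for `G ≤ U(N)` and every background `U` of the member's local class
`(bg9KP …).Reg335 c₀ α₀` (`c₀ ≤ 10`, `0 ≤ Mα₀`), with the x-free numerics `K_pl(Mα₀)·L⁴ < α₀′`, `C₀α₀′ ≤ 1/3`, `4α₀′ ≤ c₂′`, `e^{4·800((d+1)+1)²((d+1)+4)α₀′} < 2`: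
`‖(QknitY i U a)(ι)‖ ≤ 2‖a‖` (sup norm of `a`) for every bond function `a` and index bond `ι` — node00-def-Y's `IsBddOnQ (regQY G i c₀ α₀) (QknitY i) 2` unfolded
(director-ym №375 obligation (5)); §1 at the retraction `Û_ι`, whose (52) at scale `j(ι)` is dag-n06-l's `pdev_retract_bond_lt` from (3.35).
[cite: Balaban1985BackgroundPropagators, (3.12)–(3.15) p.393, (3.35) p.396; Balaban1985Averaging, Proposition 4 (130) p.38, Prop. 2 p.26, p.24] -/
theorem norm_QknitY_apply_le_of_reg335P (hGU : G ≤ unitaryUnits (Matrix (Fin N) (Fin N) ℂ))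
    {c₀ α₀ : ℝ} (hc : c₀ ≤ 10) (hMα : 0 ≤ (kGeo i).M * α₀)
    {α₀' : ℝ} (hα' : 0 < α₀') (hα3 : C0 (d + 1) * α₀' ≤ 1 / 3) (hα4 : 4 * α₀' ≤ c2' (d + 1) (ℓ + 1))
    (hexp : Real.exp (4 * (800 * (((d + 1 : ℕ) : ℝ) + 1) ^ 2 * (((d + 1 : ℕ) : ℝ) + 4)) * α₀') < 2)
    (hK : Kpl i ((kGeo i).M * α₀) * (kGeo i).L ^ 4 < α₀')
    (U : CfgY (Matrix (Fin N) (Fin N) ℂ) i) (hreg : (bg9KP (Matrix (Fin N) (Fin N) ℂ) G i).Reg335 c₀ α₀ U)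
    (a : FBondY i → Matrix (Fin N) (Fin N) ℂ) (ι : IBondY i) :
    ‖QknitY i U a ι‖ ≤ 2 * ‖a‖ := by
  letI : CStarAlgebra (Matrix (Fin N) (Fin N) ℂ) := {}
  have hG1 : ∀ u : (Matrix (Fin N) (Fin N) ℂ)ˣ, u ∈ G → ‖(u : Matrix (Fin N) (Fin N) ℂ)‖ ≤ 1 :=
    fun u hu => (B7Prop1Explicit.mem_U1.1 (unitaryUnits_le_U1 (hGU hu))).1
  have hU : ∀ μ x, U μ x ∈ unitaryUnits (Matrix (Fin N) (Fin N) ℂ) := fun μ x => hGU (mem_of_reg335P (G := G) i hreg μ x)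
  have h52 := pdev_retract_bond_lt i hG1 U hc hMα hreg hK ι
  exact norm_QknitY_apply_le_of_retract i (avgClosed_unitaryUnits (d + 1) (ℓ + 1)) hU hα' hα3 hα4 hexp ι h52 a (norm_nonneg a)
    (fun f => norm_le_pi_norm a f)

end Record

end Literature.MathematicalPhysics.QuantumFieldTheory.Balaban1983to89.B9Eq315QknitSizesY

end
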